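import Literature.AnabelianGeometry.EtaleTheta.ProfiniteAbelianZHatPow
import Literature.AnabelianGeometry.EtaleTheta.ContH1CoeffEndo
import Literature.AnabelianGeometry.EtaleTheta.ContH1ConjAction
import Literature.AnabelianGeometry.EtaleTheta.ContH1MapCoeff
import HarnessLib

/-!
# Continuous `H¹` with PROFINITE ABELIAN coefficients is a `Ẑ`-module: the powers `x^â` (`â ∈ Ẑ`) of classes
# (support file for [EtTh] Rmk. 1.6.4 (c2), `a ∈ Ẑ` form)

Neukirch–Schmidt–Wingberg, *Cohomology of Number Fields*, I §2 / II §7: `H¹(H, −)` is a functor in the topological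
`H`-module [cite: NeukirchSchmidtWingberg2008, I §2 and II §7]; for a profinite abelian coefficient group `A` the
`Ẑ`-module structure of `A` (Ribes–Zalesskii, *Profinite Groups*, §4.1: `a ↦ a^â` is a continuous endomorphism
commuting with every continuous homomorphism [cite: RibesZalesskii2010, §4.1]) therefore passes to `H¹(H, A)`.  Used for
S. Mochizuki, *The Étale Theta Function …* [EtTh], Publ. RIMS **45** (2009), Remark 1.6.4 p. 252: «any `Π_X/Π_{Y^∧} ≅ Ẑ
∋ a` acts via `(η̈^Θ)^∧ ↦ (η̈^Θ)^∧ − 2a·log(Ü) − (a²/2)·log(q_X) + log(O^×_K̈)`» [cite: MochizukiEtTh2009, Rmk 1.6.4 p.26]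
— the `Ẑ`-multiples of the classes `log(Ü)`, `log(q̈)` with coefficients `Δ_Θ ≅ Ẑ(1)` (abc-iut VNEXT «RMK164-(c2)-ZHAT»,
piece (Z3), abc-iut-L2-lead gen 9 R1364/R1371; consumer: abc-iut-f-128's assembly (Z5)).

abc-iut cell, layer L2, seat abc-iut-L2-t12 gen 12.  Over abc-iut-L2-t1's carrier `ContH1 φ A H` (continuous crossed
homomorphisms `H → A` modulo principal ones; `A ⊴ G′` abelian normal, `G` acting by conjugation through `φ : G → G′`),
abc-iut-L2-t6's coefficient-endomorphism functoriality `ContH1.mapEndo` (`ContH1CoeffEndo.lean`) and this seat's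
`ProfiniteZHatPow.zhatPow` (`ProfiniteAbelianZHatPow.lean`), all BY NAME.  Hypotheses on the coefficients: the TYPE `↥A` is
compact and totally disconnected (`[CompactSpace A] [TotallyDisconnectedSpace A]` — e.g. `A` closed in a profinite `G′`
(the hat side `ι(Δ_Θ) ≤ ((Π^tp_X)^Θ)^∧`), or `Δ_Θ` itself, compact inside the TEMPERED `(Π^tp_X)^Θ`); no hypothesis on `G`,
`G′`, `H` beyond the carrier's.

* `ContH1.zhatPow_conjNormal` (over a private continuity helper) — conjugation by any `g ∈ G′` commutes with `Ẑ`-powers on `A` (`map_zhatPow`);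
* **`ContH1.zhatPow φ A H â : H¹(H, A) →* H¹(H, A)`**, `x ↦ x^â := mapEndo (a ↦ a^â)` (ONE def), `zhatPow_mk`;
* the module laws: `zhatPow_etaZ` (`x^{η n} = xⁿ` — agreement with the group's own `ℤ`-powers), `zhatPow_mul`
  (`x^(â*b̂) = x^â · x^b̂`, `Ẑ` written multiplicatively), `zhatPow_one`, `zhatPow_inv`, `zhatPow_zhatPow`
  (`(x^â)^b̂ = x^(â ⋆ b̂)`, `â ⋆ b̂ = powZHat â b̂` the product of `Ẑ`), and `(xy)^â = x^â y^â` (it is a `MonoidHom`);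
* naturality: `conj_zhatPow` (the conjugation action of `σ ∈ G` on `H¹(H, A)`, `H ⊴ G`), `res_zhatPow`, `comap_zhatPow`
  (pull-back along a continuous `ι : G₀ → G`), `infl_zhatPow`, `mapCoeff_zhatPow` (push-forward of profinite coefficients).

ONE def, no `instance`, no notation, no `Prop`-fact; classical bookkeeping; nothing of [EtTh] is asserted; no side is taken
on [IUTchIII] Cor. 3.12; nothing here asserts that abc is proved or refuted.
-/

noncomputable section

namespace Literature.AnabelianGeometry.EtaleTheta

open scoped IsMulCommutative
open Topology

namespace ContH1

variable {G G' : Type*} [Group G] [TopologicalSpace G]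
  [Group G'] [TopologicalSpace G'] [IsTopologicalGroup G']
  (φ : G →* G') (A : Subgroup G') [A.Normal] [IsMulCommutative A] [CompactSpace A] [TotallyDisconnectedSpace A]
  (H : Subgroup G)

/-! ### Conjugation commutes with `Ẑ`-powers on the coefficients -/

omit [IsMulCommutative A] [CompactSpace A] [TotallyDisconnectedSpace A] in
/-- Conjugation by `g ∈ G′` is a continuous endomorphism of the normal subgroup `A` (private helper; abc-iut-L2-t1's
`ContH1.lean` has the same lemma privately). [folklore] -/
private theorem continuous_conjNormal_coeff (g : G') : Continuous fun a : A => MulAut.conjNormal g a :=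
  continuous_induced_rng.2 (by
    simp only [Function.comp_def, MulAut.conjNormal_apply]
    fun_prop)

/-- **Conjugation commutes with `Ẑ`-powers on `A`**: `(g a g⁻¹)^â = g a^â g⁻¹` (every continuous endomorphism of a
profinite abelian group is `Ẑ`-linear, `ProfiniteZHatPow.map_zhatPow`). [cite: RibesZalesskii2010, §4.1] -/
theorem zhatPow_conjNormal (g : G') (c : A) (a : ThetaSetting.ZHat) :
    ProfiniteZHatPow.zhatPow a (MulAut.conjNormal g c) = MulAut.conjNormal g (ProfiniteZHatPow.zhatPow a c) := by
  let F : A →ₜ* A :=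
    { toMonoidHom := (MulAut.conjNormal g : MulAut A).toMonoidHom
      continuous_toFun := continuous_conjNormal_coeff A g }
  exact (ProfiniteZHatPow.map_zhatPow F a c).symm

/-! ### The `Ẑ`-powers on `H¹(H, A)` -/

/-- **`x ↦ x^â` on `H¹(H, A)`** for profinite abelian coefficients `A` and `â ∈ Ẑ`: post-composition of cocycles with the
continuous equivariant endomorphism `a ↦ a^â` (abc-iut-L2-t6's `ContH1.mapEndo`).  In [EtTh] Rmk. 1.6.4: the multiples
`2a·log(Ü)`, `a²·log(q̈)`, `a ∈ Ẑ`. [cite: NeukirchSchmidtWingberg2008, I §2 and II §7] -/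
def zhatPow (a : ThetaSetting.ZHat) : ContH1 φ A H →* ContH1 φ A H :=
  mapEndo φ A H (ProfiniteZHatPow.zhatPow a).toMonoidHom (ProfiniteZHatPow.zhatPow a).continuous
    fun g _ c => zhatPow_conjNormal A (φ g) c a

/-- `x^â` on the class of a cocycle `f` is the class of `h ↦ f(h)^â`. [cite: NeukirchSchmidtWingberg2008, I §2 and II §7] -/
theorem zhatPow_mk (a : ThetaSetting.ZHat) (f : H → A) (hf : f ∈ contCocycles φ A H) :
    zhatPow φ A H a (ContH1.mk f hf) =
      ContH1.mk (fun h => ProfiniteZHatPow.zhatPow a (f h))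
        (mapEndoCocycle φ A H (ProfiniteZHatPow.zhatPow a).toMonoidHom (ProfiniteZHatPow.zhatPow a).continuous
          (fun g _ c => zhatPow_conjNormal A (φ g) c a) ⟨f, hf⟩).2 := rfl

/-- The cocycle `h ↦ f(h)^â` IS a continuous cocycle (membership form, for rewriting targets).
[cite: NeukirchSchmidtWingberg2008, I §2 and II §7] -/
theorem zhatPow_mem_contCocycles (a : ThetaSetting.ZHat) (f : H → A) (hf : f ∈ contCocycles φ A H) :
    (fun h => ProfiniteZHatPow.zhatPow a (f h)) ∈ contCocycles φ A H :=
  (mapEndoCocycle φ A H (ProfiniteZHatPow.zhatPow a).toMonoidHom (ProfiniteZHatPow.zhatPow a).continuous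
    (fun g _ c => zhatPow_conjNormal A (φ g) c a) ⟨f, hf⟩).2

/-! ### Module laws -/

/-- **Agreement with `ℤ`-powers**: `x^{η n} = xⁿ` (`η : ℤ → Ẑ`). [cite: NeukirchSchmidtWingberg2008, I §2 and II §7] -/
theorem zhatPow_etaZ (n : Multiplicative ℤ) (x : ContH1 φ A H) :
    zhatPow φ A H (ThetaSetting.etaZ n) x = x ^ n.toAdd := by
  induction x using QuotientGroup.induction_on with
  | H f =>
    change zhatPow φ A H _ (ContH1.mk f.1 f.2) = (ContH1.mk f.1 f.2) ^ n.toAdd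
    rw [zhatPow_mk]
    exact ContH1.mk_congr H (funext fun h => by
      rw [Pi.pow_apply]
      exact ProfiniteZHatPow.zhatPow_etaZ n (f.1 h)) _ (zpow_mem f.2 _)

/-- `x^{η 1} = x`. [cite: NeukirchSchmidtWingberg2008, I §2 and II §7] -/
theorem zhatPow_etaZ_one (x : ContH1 φ A H) :
    zhatPow φ A H (ThetaSetting.etaZ (Multiplicative.ofAdd 1)) x = x := by
  rw [zhatPow_etaZ, toAdd_ofAdd, zpow_one]

/-- **Additivity in the exponent** (`Ẑ` multiplicative): `x^(â*b̂) = x^â · x^b̂`. [cite: NeukirchSchmidtWingberg2008, I §2 and II §7] -/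
theorem zhatPow_mul (a b : ThetaSetting.ZHat) (x : ContH1 φ A H) :
    zhatPow φ A H (a * b) x = zhatPow φ A H a x * zhatPow φ A H b x := by
  induction x using QuotientGroup.induction_on with
  | H f =>
    change zhatPow φ A H _ (ContH1.mk f.1 f.2) = zhatPow φ A H _ (ContH1.mk f.1 f.2) * zhatPow φ A H _ (ContH1.mk f.1 f.2)
    rw [zhatPow_mk, zhatPow_mk, zhatPow_mk, ContH1.mk_mul_mk]
    exact ContH1.mk_congr H (funext fun h => by
      rw [Pi.mul_apply, ProfiniteZHatPow.zhatPow_mul]) _ _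

/-- `x^0 = 1` (the zero exponent is `1 : Ẑ`). [cite: NeukirchSchmidtWingberg2008, I §2 and II §7] -/
theorem zhatPow_one (x : ContH1 φ A H) : zhatPow φ A H (1 : ThetaSetting.ZHat) x = 1 := by
  induction x using QuotientGroup.induction_on with
  | H f =>
    change zhatPow φ A H 1 (ContH1.mk f.1 f.2) = 1
    rw [zhatPow_mk, ← ContH1.mk_one (φ := φ) (A' := A) H]
    exact ContH1.mk_congr H (funext fun h => ProfiniteZHatPow.zhatPow_one (f.1 h)) _ _

/-- `x^(â⁻¹) = (x^â)⁻¹` (negated exponent). [cite: NeukirchSchmidtWingberg2008, I §2 and II §7] -/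
theorem zhatPow_inv (a : ThetaSetting.ZHat) (x : ContH1 φ A H) : zhatPow φ A H a⁻¹ x = (zhatPow φ A H a x)⁻¹ :=
  eq_inv_of_mul_eq_one_left (by rw [← zhatPow_mul, inv_mul_cancel, zhatPow_one])

/-- `(xy)^â = x^â y^â`, `(xⁿ)^â = (x^â)ⁿ`: `x ↦ x^â` is a group homomorphism (pointwise restatements).
[cite: NeukirchSchmidtWingberg2008, I §2 and II §7] -/
theorem zhatPow_mul_left (a : ThetaSetting.ZHat) (x y : ContH1 φ A H) :
    zhatPow φ A H a (x * y) = zhatPow φ A H a x * zhatPow φ A H a y :=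
  map_mul _ x y

/-- [cite: NeukirchSchmidtWingberg2008, I §2 and II §7] -/
theorem zhatPow_zpow (a : ThetaSetting.ZHat) (x : ContH1 φ A H) (k : ℤ) :
    zhatPow φ A H a (x ^ k) = zhatPow φ A H a x ^ k :=
  map_zpow _ x k

/-- **Iterated powers**: `(x^â)^b̂ = x^(â ⋆ b̂)` with `â ⋆ b̂ = powZHat â b̂` the product of `Ẑ`.
[cite: NeukirchSchmidtWingberg2008, I §2 and II §7] -/
theorem zhatPow_zhatPow (a b : ThetaSetting.ZHat) (x : ContH1 φ A H) :
    zhatPow φ A H b (zhatPow φ A H a x) = zhatPow φ A H (ProfiniteZHatPow.powZHat a b) x := by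
  induction x using QuotientGroup.induction_on with
  | H f =>
    change zhatPow φ A H _ (zhatPow φ A H _ (ContH1.mk f.1 f.2)) = zhatPow φ A H _ (ContH1.mk f.1 f.2)
    rw [zhatPow_mk, zhatPow_mk, zhatPow_mk]
    exact ContH1.mk_congr H (funext fun h => ProfiniteZHatPow.zhatPow_zhatPow a b (f.1 h)) _ _

/-- The exponents `η(k) ⋆ η(n) = η(kn)`: on `H¹`, `(x^{η k})^{η n} = x^{η (kn)} = x^{kn}` — the `Ẑ`-structure extends the
`ℤ`-structure multiplicatively as well. [cite: NeukirchSchmidtWingberg2008, I §2 and II §7] -/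
theorem zhatPow_etaZ_etaZ (k n : ℤ) (x : ContH1 φ A H) :
    zhatPow φ A H (ThetaSetting.etaZ (Multiplicative.ofAdd n))
        (zhatPow φ A H (ThetaSetting.etaZ (Multiplicative.ofAdd k)) x) = x ^ (k * n) := by
  rw [zhatPow_zhatPow, ProfiniteZHatPow.powZHat_etaZ_etaZ, zhatPow_etaZ, toAdd_ofAdd]

/-! ### Naturality: conjugation, restriction, pull-back, inflation, coefficient push-forward -/

/-- **The conjugation action commutes with `Ẑ`-powers**: `σ·(x^â) = (σ·x)^â` for `σ ∈ G`, `H ⊴ G` (so the `Ẑ`-form of a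
conjugation formula makes sense termwise). [cite: NeukirchSchmidtWingberg2008, I §2 and II §7] -/
theorem conj_zhatPow [IsTopologicalGroup G] [H.Normal] (σ : G) (a : ThetaSetting.ZHat) (x : ContH1 φ A H) :
    conj φ A σ (zhatPow φ A H a x) = zhatPow φ A H a (conj φ A σ x) := by
  induction x using QuotientGroup.induction_on with
  | H f =>
    have hconj : ∀ (g : H → A) (hg : g ∈ contCocycles φ A H), conj φ A σ (ContH1.mk g hg) =
        ContH1.mk (conjCocycle φ A σ ⟨g, hg⟩).1 (conjCocycle φ A σ ⟨g, hg⟩).2 := fun _ _ => rfl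
    change conj φ A σ (zhatPow φ A H a (ContH1.mk f.1 f.2)) = zhatPow φ A H a (conj φ A σ (ContH1.mk f.1 f.2))
    rw [zhatPow_mk, hconj, hconj, zhatPow_mk]
    refine ContH1.mk_congr H (funext fun h => ?_) _ _
    change MulAut.conjNormal (φ σ) (ProfiniteZHatPow.zhatPow a (f.1 (MulAut.conjNormal σ⁻¹ h))) =
      ProfiniteZHatPow.zhatPow a (MulAut.conjNormal (φ σ) (f.1 (MulAut.conjNormal σ⁻¹ h)))
    rw [zhatPow_conjNormal]

/-- `Ẑ`-powers commute with restriction to a smaller subgroup. [cite: NeukirchSchmidtWingberg2008, I §2 and II §7] -/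
theorem res_zhatPow {H₁ : Subgroup G} (hle : H₁ ≤ H) (a : ThetaSetting.ZHat) (x : ContH1 φ A H) :
    ContH1.res φ A hle (zhatPow φ A H a x) = zhatPow φ A H₁ a (ContH1.res φ A hle x) := by
  induction x using QuotientGroup.induction_on with
  | H f => rfl

/-- `Ẑ`-powers commute with pull-back along a continuous homomorphism `ι : G₀ → G` (abc-iut-w4-d014's `ContH1.comap`).
[cite: NeukirchSchmidtWingberg2008, I §2 and II §7] -/
theorem comap_zhatPow {G₀ : Type*} [Group G₀] [TopologicalSpace G₀] (ι : G₀ →* G) (hι : Continuous ι)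
    {H₀ : Subgroup G₀} (h : H₀.map ι ≤ H) (a : ThetaSetting.ZHat) (x : ContH1 φ A H) :
    ContH1.comap φ A ι hι h (zhatPow φ A H a x) = zhatPow (φ.comp ι) A H₀ a (ContH1.comap φ A ι hι h x) := by
  induction x using QuotientGroup.induction_on with
  | H f => rfl

/-- `Ẑ`-powers commute with inflation along a continuous `ψ : G₀ → G′` (abc-iut-L2-t1's `ContH1.infl`, e.g.
`Π^tp_Ÿ → (Π^tp_Ÿ)^Θ`). [cite: NeukirchSchmidtWingberg2008, I §2 and II §7] -/
theorem infl_zhatPow {G₀ : Type*} [Group G₀] [TopologicalSpace G₀] (ψ : G₀ →* G') (hψ : Continuous ψ)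
    {H₀ : Subgroup G₀} {H' : Subgroup G'} (h : H₀.map ψ ≤ H') (a : ThetaSetting.ZHat)
    (x : ContH1 (MonoidHom.id G') A H') :
    ContH1.infl A ψ hψ h (zhatPow (MonoidHom.id G') A H' a x) = zhatPow ψ A H₀ a (ContH1.infl A ψ hψ h x) := by
  induction x using QuotientGroup.induction_on with
  | H f => rfl

/-- **`Ẑ`-powers commute with the push-forward of profinite abelian coefficients** along a continuous homomorphism of
ambient pairs `ψ : (G′, A) → (G″, A″)` (abc-iut-w6-d081's `ContH1.mapCoeff`; in [EtTh] Rmk. 1.6.4 the passage to the hat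
classes along the completion `ι`). [cite: NeukirchSchmidtWingberg2008, I §2 and II §7] -/
theorem mapCoeff_zhatPow {G'' : Type*} [Group G''] [TopologicalSpace G''] [IsTopologicalGroup G'']
    (ψ : G' →* G'') (hψ : Continuous ψ) (A'' : Subgroup G'') [A''.Normal] [IsMulCommutative A''] [CompactSpace A'']
    [TotallyDisconnectedSpace A''] (hA : A.map ψ ≤ A'') (a : ThetaSetting.ZHat) (x : ContH1 φ A H) :
    mapCoeff φ A ψ hψ A'' hA H (zhatPow φ A H a x) = zhatPow (ψ.comp φ) A'' H a (mapCoeff φ A ψ hψ A'' hA H x) := by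
  induction x using QuotientGroup.induction_on with
  | H f =>
    change mapCoeff φ A ψ hψ A'' hA H (zhatPow φ A H a (ContH1.mk f.1 f.2)) =
      zhatPow (ψ.comp φ) A'' H a (mapCoeff φ A ψ hψ A'' hA H (ContH1.mk f.1 f.2))
    rw [zhatPow_mk, mapCoeff_mk, mapCoeff_mk, zhatPow_mk]
    refine ContH1.mk_congr H (funext fun h => ?_) _ _
    let F : A →ₜ* A'' :=
      { toMonoidHom := coeffHom A ψ A'' hA, continuous_toFun := continuous_coeffHom A ψ A'' hA hψ }
    exact ProfiniteZHatPow.map_zhatPow F a (f.1 h)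

end ContH1

end Literature.AnabelianGeometry.EtaleTheta

end
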